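import Summits.ValiantsHypothesis.ValiantsHypothesis.Theorems.KPlusLogSqLawTropicalBStaircaseDesign
import Summits.ValiantsHypothesis.ValiantsHypothesis.Theorems.LacunarySymmetroidMatrixDescartesCensusTropicalKLaw

/-!
# `KPlusLogSqLaw` / Lifting layer — same-`K` real doubling; the general row predicate; no real exponent law

HONEST FRAMING.  Object-search cell `pub-symmetroid` (Valiant), helper bookkeeping for the OPEN item `WeakLifting`
(stmt-ValiantsHypothesis-19561; tropical row ⇒ real row) in census currency (`RealRootLawAt`,
`Theorems/LacunarySymmetroidMatrixDescartesCensusDefs.lean`).  Typed from the cell's ideation sketch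
`HOME/pub-symmetroid-conjb-3/ConjB3SketchR6.lean` (seat conjb-3 g6, 2026-08-26, «round 6»; proofs verbatim, namespace
renamed, imports lowered to the two modules actually used).  Nothing here is asserted about `KPlusLogSqLaw`,
`WeakLifting`, `MatrixDescartes` (stmt-ValiantsHypothesis-18050) or `VP ≠ VNP`; the census registers are untouched.

Content:
* `GenRootLawAt m K B` — the census row for GENERAL (not necessarily symmetric) real pencils, and the trivial direction
  `realRootLawAt_of_genRootLawAt`.
* `genRootLawAt_of_realRootLawAt_double` (PROVED): `RealRootLawAt (m+m) K B → GenRootLawAt m K B` at the SAME `K`, by the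
  doubling `[[0, P], [Pᵀ, 0]]` (`det = ± (det P)²`, same distinct real zeros).  The tree's
  `MatrixDescartes.Negative.SD` doubling uses `[[0, P], [Pᵀ, 1]]` and costs one extra constant letter (format
  `(m+m, K+1)`); this removes the `+1`.
* `RealExponentLaw e` — the real twin of the (refuted) tropical `TropicalCensus.TropExponentLaw e`: «some `C` makes
  `ζ(m,K) ≤ 2^{C·K} · m^e` for all formats», NOT asserted; `tropExponentLaw_of_realExponentLaw` (patchworking
  `le_card_posRoots_patch` + the `(m+m, K+1)` doubling) and `not_realExponentLaw` (PROVED): it fails for every `e`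
  (`WalkDesign.not_tropExponentLaw`).  Consistent with the cell's Conjecture B, which allows `m^{C log m}` per column;
  recorded because the real side of the cell's dead list had only fixed-format / fixed-`K` entries.
-/

-- `Summit.ValiantsHypothesis.ValiantsHypothesis.…` repeats a component by the D-0017 layout
-- (single-conjunct summit), which the `dupNamespace` linter flags; the name is mandated.
set_option linter.dupNamespace false

namespace Summit.ValiantsHypothesis.ValiantsHypothesis.Theorems.KPlusLogSqLaw.RealDoubling

open Summit.ValiantsHypothesis.ValiantsHypothesis.Theorems.MatrixDescartes.Negative
open Summit.ValiantsHypothesis.ValiantsHypothesis.Theorems.LacunarySymmetroidMatrixDescartes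
open Summit.ValiantsHypothesis.ValiantsHypothesis.Theorems.LacunarySymmetroidMatrixDescartes.TropicalCensus
open scoped BigOperators Matrix
open Polynomial

/-- **Census row predicate, general pencils.** `GenRootLawAt m K B`: every real (not necessarily symmetric)
lacunary pencil of format `(m, K)` has at most `B` distinct real zeros of its determinant. [definition of the cell] -/
def GenRootLawAt (m K B : ℕ) : Prop :=
  ∀ (d : Fin K → ℕ) (E : Fin K → Matrix (Fin m) (Fin m) ℝ),
    (Matrix.det (∑ l, ((Polynomial.X : Polynomial ℝ) ^ d l) • (E l).map Polynomial.C)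
      ).roots.toFinset.card ≤ B

/-- general rows imply symmetric rows (trivial direction). [folklore] -/
theorem realRootLawAt_of_genRootLawAt {m K B : ℕ} (h : GenRootLawAt m K B) : RealRootLawAt m K B :=
  fun d S _ => h d S

section DoublingSameK

variable {m K : ℕ}

/-- [definition of the cell] block coefficients of the same-`K` doubling on `Fin m ⊕ Fin m`: `[[0, Eₗ], [Eₗᵀ, 0]]`. -/
def BD0 (E : Fin K → Matrix (Fin m) (Fin m) ℝ) : Fin K → Matrix (Fin m ⊕ Fin m) (Fin m ⊕ Fin m) ℝ :=
  fun l => Matrix.fromBlocks 0 (E l) (E l)ᵀ 0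

/-- [definition of the cell] the doubled coefficients, reindexed to `Fin (m + m)`. -/
def SD0 (E : Fin K → Matrix (Fin m) (Fin m) ℝ) : Fin K → Matrix (Fin (m + m)) (Fin (m + m)) ℝ :=
  fun l => Matrix.reindex finSumFinEquiv finSumFinEquiv (BD0 E l)

/-- each doubled block coefficient `[[0, Eₗ], [Eₗᵀ, 0]]` is symmetric. [folklore] -/
theorem BD0_isSymm (E : Fin K → Matrix (Fin m) (Fin m) ℝ) (l : Fin K) : (BD0 E l).IsSymm := by
  unfold BD0 Matrix.IsSymm
  rw [Matrix.fromBlocks_transpose]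
  simp

/-- each reindexed doubled coefficient is symmetric. [folklore] -/
theorem SD0_isSymm (E : Fin K → Matrix (Fin m) (Fin m) ℝ) (l : Fin K) : (SD0 E l).IsSymm := by
  unfold SD0 Matrix.IsSymm
  rw [Matrix.transpose_reindex, (BD0_isSymm E l).eq]

/-- the doubled pencil on `Fin m ⊕ Fin m` is `[[0, P], [Pᵀ, 0]]`. [folklore] -/
theorem pencil_BD0 (d : Fin K → ℕ) (E : Fin K → Matrix (Fin m) (Fin m) ℝ) :
    (∑ l, (X : ℝ[X]) ^ d l • (BD0 E l).map Polynomial.C) =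
      Matrix.fromBlocks 0 (∑ l, (X : ℝ[X]) ^ d l • (E l).map Polynomial.C)
        (∑ l, (X : ℝ[X]) ^ d l • (E l).map Polynomial.C)ᵀ 0 := by
  ext (i | i) (j | j) <;> simp [BD0, Matrix.sum_apply]

/-- the reindexed doubled pencil is the reindexing of the block pencil. [folklore] -/
theorem pencil_SD0 (d : Fin K → ℕ) (E : Fin K → Matrix (Fin m) (Fin m) ℝ) :
    (∑ l, (X : ℝ[X]) ^ d l • (SD0 E l).map Polynomial.C) =
      Matrix.reindex finSumFinEquiv finSumFinEquiv (∑ l, (X : ℝ[X]) ^ d l • (BD0 E l).map Polynomial.C) := by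
  ext i j
  simp [SD0, Matrix.sum_apply]

/-- `[[0, P], [Pᵀ, 0]] = [[P, 0], [0, Pᵀ]] · [[0, 1], [1, 0]]`. [folklore] -/
theorem fromBlocks_antidiag_eq {R : Type*} [CommRing R] (P : Matrix (Fin m) (Fin m) R) :
    Matrix.fromBlocks (0 : Matrix (Fin m) (Fin m) R) P Pᵀ 0 =
      Matrix.fromBlocks P 0 0 Pᵀ * Matrix.fromBlocks (0 : Matrix (Fin m) (Fin m) R) (1 : Matrix (Fin m) (Fin m) R)
        (1 : Matrix (Fin m) (Fin m) R) 0 := by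
  rw [Matrix.fromBlocks_multiply]
  simp

/-- the block swap `[[0,1],[1,0]]` squares to the identity, so its determinant squares to `1`. [folklore] -/
theorem det_swap_sq {R : Type*} [CommRing R] :
    (Matrix.fromBlocks (0 : Matrix (Fin m) (Fin m) R) (1 : Matrix (Fin m) (Fin m) R) (1 : Matrix (Fin m) (Fin m) R) 0).det *
      (Matrix.fromBlocks (0 : Matrix (Fin m) (Fin m) R) (1 : Matrix (Fin m) (Fin m) R) (1 : Matrix (Fin m) (Fin m) R) 0).det
        = 1 := by
  rw [← Matrix.det_mul, Matrix.fromBlocks_multiply]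
  simp

/-- `det [[0, P], [Pᵀ, 0]] = u · (det P)²` with `u² = 1`. [folklore] -/
theorem det_pencil_SD0 (d : Fin K → ℕ) (E : Fin K → Matrix (Fin m) (Fin m) ℝ) :
    (∑ l, (X : ℝ[X]) ^ d l • (SD0 E l).map Polynomial.C).det =
      (∑ l, (X : ℝ[X]) ^ d l • (E l).map Polynomial.C).det ^ 2 *
        (Matrix.fromBlocks (0 : Matrix (Fin m) (Fin m) ℝ[X]) (1 : Matrix (Fin m) (Fin m) ℝ[X])
          (1 : Matrix (Fin m) (Fin m) ℝ[X]) 0).det := by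
  rw [pencil_SD0, Matrix.det_reindex_self, pencil_BD0, fromBlocks_antidiag_eq, Matrix.det_mul,
    Matrix.det_fromBlocks_zero₂₁, Matrix.det_transpose]
  ring

/-- the same-`K` doubling has exactly the same distinct real zeros. [folklore] -/
theorem card_roots_SD0 (d : Fin K → ℕ) (E : Fin K → Matrix (Fin m) (Fin m) ℝ) :
    (∑ l, (X : ℝ[X]) ^ d l • (SD0 E l).map Polynomial.C).det.roots.toFinset =
      (∑ l, (X : ℝ[X]) ^ d l • (E l).map Polynomial.C).det.roots.toFinset := by
  rw [det_pencil_SD0]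
  set p := (∑ l, (X : ℝ[X]) ^ d l • (E l).map Polynomial.C).det with hp
  set u := (Matrix.fromBlocks (0 : Matrix (Fin m) (Fin m) ℝ[X]) (1 : Matrix (Fin m) (Fin m) ℝ[X])
    (1 : Matrix (Fin m) (Fin m) ℝ[X]) 0).det with hu
  have hu1 : u * u = 1 := det_swap_sq
  have hunit : IsUnit u := IsUnit.of_mul_eq_one u hu1
  have hu0 : u ≠ 0 := hunit.ne_zero
  -- `u` is a nonzero constant
  obtain ⟨c, hc⟩ := Polynomial.isUnit_iff.mp hunit
  rcases hc with ⟨hcU, hcu⟩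
  by_cases hp0 : p = 0
  · simp [hp0]
  · have hp2 : p ^ 2 ≠ 0 := pow_ne_zero _ hp0
    rw [Polynomial.roots_mul (mul_ne_zero hp2 hu0), Polynomial.roots_pow, ← hcu, Polynomial.roots_C, add_zero,
      Multiset.toFinset_nsmul _ _ two_ne_zero]

/-- **Same-`K` doubling transfer** (PROVED): a symmetric row at size `m + m` bounds the general row at size `m`, with the
same `K` and the same exponents. [folklore] Symmetric doubling of determinantal representations
(Grenet–Kaltofen–Koiran–Portier, arXiv:1007.3804 §2), here without the extra unit letter of the tree's `SD`. -/
theorem genRootLawAt_of_realRootLawAt_double {B : ℕ} (h : RealRootLawAt (m + m) K B) : GenRootLawAt m K B := by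
  intro d E
  have := h d (SD0 E) (SD0_isSymm E)
  rwa [card_roots_SD0] at this

end DoublingSameK

/-- **Real exponent law with exponent `e`** (candidate shape, NOT asserted; typed to be REFUTED below): some `C` makes
`ζ(m,K) ≤ 2^{C·K} · m^e` for all formats — the real twin of `TropicalCensus.TropExponentLaw e`. [candidate of the cell; no citation exists] -/
def RealExponentLaw (e : ℕ) : Prop :=
  ∃ C : ℕ, ∀ m K : ℕ, RealRootLawAt m K (2 ^ (C * K) * m ^ e)

/-- real exponent law ⇒ tropical exponent law (patchworking + the tree's `(m+m, K+1)` doubling). [folklore] -/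
theorem tropExponentLaw_of_realExponentLaw {e : ℕ} (h : RealExponentLaw e) : TropExponentLaw e := by
  obtain ⟨C, hC⟩ := h
  refine ⟨2 * C + e, fun m K => ?_⟩
  rcases Nat.eq_zero_or_pos K with hK | hK
  · subst hK; exact tropRootLawAt_zero m _
  intro d v ε n θ p hε hθ hdom halt
  obtain ⟨T, hT⟩ := le_card_posRoots_patch d v ε hε θ hθ p hdom halt
  have hrow := hC (m + m) (K + 1) (dD d) (SD T) (SD_isSymm T)
  rw [card_roots_SD] at hrow
  have hn : n ≤ 2 ^ (C * (K + 1)) * (m + m) ^ e := hT.trans ((Finset.card_filter_le _ _).trans hrow)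
  apply hn.trans
  have h2m : (m + m) ^ e = 2 ^ e * m ^ e := by rw [← two_mul, mul_pow]
  rw [h2m, ← mul_assoc, ← pow_add]
  apply Nat.mul_le_mul_right
  apply Nat.pow_le_pow_right (by norm_num)
  nlinarith

/-- **No real exponent law** (PROVED): for every `e` the law `ζ(m,K) ≤ 2^{CK}·m^e` fails at some format — the real
`(m, K)` table has unbounded `m`-exponent as `K` grows (staircase designs, patchworked and doubled).  Consistent with
Conjecture B (`m^{C log m}` per column is allowed); it only records that no polynomial-in-`m` law with
exponential-in-`K` slack exists on the REAL side either. [folklore] -/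
theorem not_realExponentLaw (e : ℕ) : ¬ RealExponentLaw e :=
  fun h => Summit.ValiantsHypothesis.ValiantsHypothesis.Theorems.KPlusLogSqLaw.WalkDesign.not_tropExponentLaw e
    (tropExponentLaw_of_realExponentLaw h)

end Summit.ValiantsHypothesis.ValiantsHypothesis.Theorems.KPlusLogSqLaw.RealDoubling
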